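import Literature.Probability.RandomPlanarGeometry.SLERestrictionMartingaleExists
import Literature.Probability.RandomPlanarGeometry.CritPercSLESimplePathProofs
import Literature.Probability.RandomPlanarGeometry.RohdeSchrammCor35Proofs
import HarnessLib

/-!
# [LSW] Prop. 5.2/5.3 at `κ = 8/3` (the restriction martingale exists): the discharge

This file discharges the named fact
`Literature.Probability.RandomPlanarGeometry.sle_exists_isRestrictionMartingale`
(`SLERestrictionMartingale`):

* G. F. Lawler, O. Schramm, W. Werner, *Conformal restriction: the chordal case*, J. Amer. Math.
  Soc. **16** (2003) 917–955, arXiv:math/0209343 (**[LSW]**), §5: Prop. 5.2 ("The process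
  `Y⁰_t = h_t'(W_t)^a`, `t < T`, is a local martingale for all `A ∈ 𝒬*` if and only if
  `κ = 8/3` and `a = 5/8`"), Prop. 5.3 ("If `κ ≤ 8/3`, then `Y_t` is a bounded martingale (in
  fact, `0 ≤ Y_t ≤ 1`)"), and the first sentence of the proof of Thm. 6.1 (§6: "By the
  martingale convergence theorem, the a.s. limit `Y_T := lim_{t ↗ T} Y_t` exists").

The fact is a decomposition child of [LSW] Thm. 6.1 (`sle_restriction_eightThirds`, glue
`sle_restriction_eightThirds_of_limits` / `_of_martingale` in `SLERestrictionMartingale`). Its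
proof in the tree is `sle_exists_isRestrictionMartingale_of_trace_facts`
(`SLERestrictionMartingaleExists`): the martingale property of `Φ'_{A_t − W_t}(0)^{5/8}` along
the localising times by conditional increments (`SLERestrictionOneStep`,
`SLERestrictionLocalMartingale`), the terminal limit by the nested stopped-martingale
convergence (`SLERestrictionConvergence`), and the identification of the hull hitting time with
the trace hitting time for a chain generated by a simple curve. That theorem takes the two
Rohde–Schramm trace facts as hypotheses; both are theorems of the tree:

1. `hasSLETrace_of_ne_eight` (Rohde–Schramm 2005, Thm. 5.1: SLE_κ, `κ ≠ 8`, is generated by a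
   curve) — `hasSLETrace_of_ne_eight_holds` (`RohdeSchrammCor35Proofs`, from Cor. 3.5 /
   Thm. 3.6 / Thm. 4.1);
2. `ae_isSimpleTrace_sleTrace_of_le_four (κ := 8/3)` (Rohde–Schramm 2005, Thm. 6.1: for
   `0 < κ ≤ 4` the trace is a.s. simple) — `ae_isSimpleTrace_sleTrace_of_le_four_of_hasSLETrace_fact`
   (`CritPercSLESimplePathProofs`, from Thm. 5.1 and the proved Lemma 6.2
   `sle_swallowingTime_ofReal_eq_top_holds`).

Hence the closed discharge below (the same closed term already feeds the discharge of the
parent, `sle_restriction_eightThirds_holds` in `RestrictionHullsHolds`). No new definition, no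
new named fact; axioms `propext`, `Classical.choice`, `Quot.sound`.

## References

* [LSW] G. F. Lawler, O. Schramm, W. Werner, *Conformal restriction: the chordal case*, J. Amer.
  Math. Soc. 16 (2003) 917–955: Prop. 5.2, Prop. 5.3 (§5), proof of Thm. 6.1 (§6).
  [LawlerSchrammWerner2003Restriction]
* S. Rohde, O. Schramm, *Basic properties of SLE*, Ann. of Math. 161 (2005) 883–924: Thm. 5.1,
  Lemma 6.2, Thm. 6.1. [RohdeSchramm2005]
-/

open scoped NNReal

namespace Literature.Probability.RandomPlanarGeometry

/-- **Rohde–Schramm Thm. 6.1 at `κ = 8/3`**: the SLE_{8/3} trace is almost surely a simple trace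
(the form `ae_isSimpleTrace_sleTrace_of_le_four (κ := 8/3)` consumed by the restriction files),
from Thm. 5.1 (`hasSLETrace_of_ne_eight_holds`) and the tree's proof of Thm. 6.1 given Thm. 5.1
(`ae_isSimpleTrace_sleTrace_of_le_four_of_hasSLETrace_fact`). [cite: RohdeSchramm2005, Thm 6.1] -/
theorem ae_isSimpleTrace_sleTrace_eightThirds :
    ae_isSimpleTrace_sleTrace_of_le_four (κ := (8 : ℝ≥0) / 3) :=
  ae_isSimpleTrace_sleTrace_of_le_four_of_hasSLETrace_fact hasSLETrace_of_ne_eight_holds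

/-- **[LSW] Prop. 5.2 with Prop. 5.3 at `κ = 8/3`, and the martingale convergence step of the
proof of Thm. 6.1** (`Literature.Probability.RandomPlanarGeometry.sle_exists_isRestrictionMartingale`
holds): for every `A ∈ 𝒬*` there is a process `Y` with `0 ≤ Y ≤ 1`, an `𝓕ᵂ`-martingale under the
Wiener measure, equal a.s. to `Φ'_{A_t − W_t}(0)^{5/8} = h_t'(W_t)^{5/8}` before the hitting time `T`
of `A` by the SLE_{8/3} trace, frozen at its left limit `Y_T` from `T` on, and convergent at `∞`
on `{T = ∞}`. The tree's proof from the Rohde–Schramm trace facts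
(`sle_exists_isRestrictionMartingale_of_trace_facts`) fed with Thm. 5.1
(`hasSLETrace_of_ne_eight_holds`) and Thm. 6.1 at `κ = 8/3` (`ae_isSimpleTrace_sleTrace_eightThirds`).
[cite: LawlerSchrammWerner2003Restriction, Prop. 5.2 and Prop. 5.3 (§5), proof of Thm. 6.1 (§6)] -/
theorem sle_exists_isRestrictionMartingale_holds : sle_exists_isRestrictionMartingale :=
  sle_exists_isRestrictionMartingale_of_trace_facts hasSLETrace_of_ne_eight_holds
    ae_isSimpleTrace_sleTrace_eightThirds

end Literature.Probability.RandomPlanarGeometry
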